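import Literature.NumberTheory.Rogawski1990.AdelicStableConjugacyG2
import Literature.NumberTheory.Rogawski1990.AdelicStableOrbitalSupportFinite
import Literature.NumberTheory.Rogawski1990.AdelicStableClassSupportFiniteH
import Literature.NumberTheory.Automorphic.UnramifiedIntegralConjugacyOfCharpoly
import Literature.NumberTheory.Automorphic.AdelicGLnGlue
import Literature.NumberTheory.Automorphic.GLnFiniteAdeleRestrictedProduct
import Literature.NumberTheory.Automorphic.UnitaryGroupLocalCongr
import HarnessLib

/-!
# Local → adelic gluing of conjugators in `GL_n(𝔸_K)`; an adelic point placewise stably conjugate to a regular rational `γ₀` IS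
# `GL_N(𝔸_L)`-conjugate to `γ₀ ⊗ 1`; placewise `U(H)`-conjugacy to a regular rational `δ` IS adelic `U(H)(𝔸)`-conjugacy
(Rogawski, *Automorphic representations of unitary groups in three variables* (1990), §3.3 pp. 21–22 «`𝒪_st(γ∕𝐀) = {γ′ ∈ 𝐆 : γ′_v` is stably
conjugate to `γ` in `G_v` for all `v}`», §5.4 p. 72; Kottwitz, *Stable trace formula: elliptic singular terms* (1986), Prop. 7.1; Borel–Jacquet (1979) §4.1)

Topic `NumberTheory/Rogawski1990` (§2–§3) on a generic §1 in `Literature.NumberTheory.Automorphic` (`GLn.…`); THEOREMS ONLY (no definition, no instance,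
no named fact, no `sorry`).  Row (G-a) = R6b of the HCML F0∕P3a census `CENSUS-R6R7-CartanObstruction` (F0P5a-p03 (g4)): the GL-reading of the adelic
stable class and the gluing converse its Cartan-obstruction count (R7) consumes.

* §1 (generic `GL_n` over a number field `K`): `GLn.eq_of_toMixed_eq_of_forall_evalAt_eq` — an element of `GL_n(𝔸_K)` is determined by its archimedean
  component (★ `GLn.toMixed`) and its components `(g_f)_w` (★ `GLn.evalAt`, ★ `GLn.sndHom`); `GLn.exists_toMixed_eq_evalAt_eq` — local components,
  integral for almost all `w`, and an archimedean component GLUE (★ `GLn.restrictedPiEquiv`, ★ `GLn.ofInfinite`, ★ `GLn.ofFinite`);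
  **`GLn.isConj_of_isConj_toMixed_of_forall_exists_conj`** — THE GLUING LEMMA in `GL_n(𝔸_K)`: conjugate at `∞`, conjugate at every finite `w`, and
  conjugate BY AN INTEGRAL ELEMENT at almost every `w` ⇒ conjugate in `GL_n(𝔸_K)`; `GLn.eventually_exists_mem_glInt_conj_of_forall_isConj` — for a
  rational `γ` with SEPARABLE characteristic polynomial and any adelic `y` placewise conjugate to `γ ⊗ 1`, the conjugators can be taken in `GL_n(𝒪_w)`
  for almost all `w` ([Kt₄] Prop. 7.1 for `GL_n`, ★ `exists_mem_glInt_conj_eq_of_charpoly_eq`); hence **`GLn.isConj_toAdeleGL_of_isConj_toMixed_of_forall_isConj`**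
  — an adelic matrix everywhere locally conjugate to a regular semisimple rational `γ` is `GL_n(𝔸_K)`-conjugate to `γ ⊗ 1`.
* §2 (`U(H)` over a CM field `L`, ★ `cmDatum L N H`, any `N`): **`UnitaryGroup.exists_conj_toAdeleGL_eq_of_isStablyConj`** — `g ∈ U(H)(𝔸)` stably
  conjugate to `(δ ⊗ 1)_v` at every finite `v` and to `δ ⊗ 1` at `∞`, `δ ∈ U(H)(L⁺)` regular ⇒ `x (δ ⊗ 1) x⁻¹ = g` for some `x ∈ GL_N(𝔸_L)`; on the self
  carrier of ★ `MatchingAdeleG₂`: **`MatchingAdeleG₂.exists_gl_conj_eq_adele`** — every matching adèle over a regular `γ₀` is `GL₃(𝔸_L)`-conjugate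
  to `γ₀ ⊗ 1` («`γ′ ∈ 𝒪_st(γ∕𝐀)`» read in `GL₃(𝐀)`).
* §3 the CONVERSE gluing in `U(H)(𝔸)`: **`UnitaryGroup.isConj_toAdelic_of_isConj_arch_of_forall_isConj_toLocal`** — `g ∈ U(H)(𝔸)` conjugate IN
  `U(H)(L⁺_v)` to `(δ ⊗ 1)_v` at every finite `v` and in `U(H)(L ⊗ ℝ)` at `∞`, `δ` regular, `H` hermitian invertible ⇒ `g ∼ δ ⊗ 1` in `U(H)(𝔸)` —
  ★ `UnitaryGroup.isConj_of_isConj_archPart_of_forall_exists_conj` with its «integral conjugators a.e.» clause DISCHARGED by [Kt₄] Prop. 7.1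
  (★ `eventually_forall_integralConj_cmDatum_of_charpoly_eq`) and the a.e. integrality of adelic points (★ `eventually_toLocal_mem_cmLocalIntegralLevel`);
  on ★ `MatchingAdeleG₂`: **`MatchingAdeleG₂.isRationalOver_of_isConj_arch_of_forall_isConj_toLocal`**.

## References
* J. D. Rogawski, *Automorphic Representations of Unitary Groups in Three Variables*, Ann. of Math. Stud. 123 (1990), §3.3 pp. 21–22, §5.4 p. 72
  [Rogawski1990].
* R. E. Kottwitz, *Stable trace formula: elliptic singular terms*, Math. Ann. 275 (1986), Prop. 7.1 [Kottwitz1986].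
* A. Borel, H. Jacquet, *Automorphic forms and automorphic representations*, Proc. Sympos. Pure Math. 33.1 (1979), §4.1 [BorelJacquet1979].
-/

set_option autoImplicit false

noncomputable section

open NumberField IsDedekindDomain Filter Polynomial
open scoped Matrix RestrictedProduct

namespace Literature.NumberTheory.Automorphic

/-! ## §1 Gluing local conjugators into an adelic one in `GL_n(𝔸_K)` -/

section GLGluing

variable {n : ℕ} {K : Type} [Field K] [NumberField K]

/-- **An element of `GL_n(𝔸_K)` is determined by its archimedean component and its local components**: if `x_∞ = y_∞` (★ `GLn.toMixed`) and
`(x_f)_w = (y_f)_w` for every finite place `w` (★ `GLn.evalAt` of ★ `GLn.sndHom`), then `x = y` (`GL_n(𝔸_K^∞) = ∏'_w GL_n(K_w)`, ★ `GLn.restrictedPiEquiv`;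
`g = (g_∞, g_f)`, ★ `GLn.ext_of_fstHom_of_sndHom`). [cite: BorelJacquet1979, §4.1] -/
theorem GLn.eq_of_toMixed_eq_of_forall_evalAt_eq {x y : GL (Fin n) (AdeleRing (𝓞 K) K)} (ha : GLn.toMixed n K x = GLn.toMixed n K y)
    (hv : ∀ w : HeightOneSpectrum (𝓞 K), GLn.evalAt n K w (GLn.sndHom n K x) = GLn.evalAt n K w (GLn.sndHom n K y)) : x = y := by
  refine GLn.ext_of_fstHom_of_sndHom ((GLn.infiniteEquivMixed n K).injective ha) ?_
  apply (GLn.restrictedPiEquiv n K).injective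
  exact RestrictedProduct.ext _ _ fun w => hv w

/-- **Local components glue in `GL_n(𝔸_K)`**: given `y_w ∈ GL_n(K_w)` for every finite place `w` with `y_w ∈ GL_n(𝒪_w)` for almost all `w` and
`a ∈ GL_n(K ⊗ ℝ)`, there is `x ∈ GL_n(𝔸_K)` with `x_∞ = a` and `(x_f)_w = y_w` for all `w` (`x = (a, 1)·(1, x_f)` with `x_f` the restricted-product
tuple, ★ `GLn.restrictedPiEquiv`, ★ `GLn.ofInfinite`, ★ `GLn.ofFinite`). [cite: BorelJacquet1979, §4.1] -/
theorem GLn.exists_toMixed_eq_evalAt_eq (a : GL (Fin n) (mixedEmbedding.mixedSpace K)) (y : ∀ w : HeightOneSpectrum (𝓞 K), GL (Fin n) (w.adicCompletion K))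
    (hy : ∀ᶠ w in cofinite, y w ∈ glInt n (w.adicCompletion K)) :
    ∃ x : GL (Fin n) (AdeleRing (𝓞 K) K), GLn.toMixed n K x = a ∧ ∀ w, GLn.evalAt n K w (GLn.sndHom n K x) = y w := by
  let z : Πʳ w : HeightOneSpectrum (𝓞 K), [GL (Fin n) (w.adicCompletion K), glInt n (w.adicCompletion K)] := RestrictedProduct.mk y hy
  refine ⟨GLn.ofInfinite n K a * GLn.ofFinite n K ((GLn.restrictedPiEquiv n K).symm z), ?_, fun w => ?_⟩
  · rw [map_mul, GLn.toMixed_ofInfinite, GLn.toMixed_ofFinite, mul_one]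
  · rw [map_mul, GLn.sndHom_ofInfinite, one_mul, GLn.sndHom_ofFinite, GLn.evalAt_restrictedPiEquiv_symm]
    rfl

/-- **THE GLUING LEMMA in `GL_n(𝔸_K)` — local conjugacy everywhere, integral conjugators almost everywhere ⇒ adelic conjugacy**: for
`x, y ∈ GL_n(𝔸_K)`, if `x_∞ ∼ y_∞` in `GL_n(K ⊗ ℝ)`, `(x_f)_w ∼ (y_f)_w` in `GL_n(K_w)` for every finite `w`, and for almost every `w` some conjugator can be
taken IN `GL_n(𝒪_w)`, then `x ∼ y` in `GL_n(𝔸_K)` — choose a conjugator at each place (integral wherever possible), glue (`GLn.exists_toMixed_eq_evalAt_eq`),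
compare place by place (`GLn.eq_of_toMixed_eq_of_forall_evalAt_eq`).  The `GL_n` twin of ★ `UnitaryGroup.isConj_of_isConj_archPart_of_forall_exists_conj`.
[cite: Rogawski1990, §3.3 p. 21] [cite: BorelJacquet1979, §4.1] -/
theorem GLn.isConj_of_isConj_toMixed_of_forall_exists_conj {x y : GL (Fin n) (AdeleRing (𝓞 K) K)}
    (ha : IsConj (GLn.toMixed n K x) (GLn.toMixed n K y))
    (hv : ∀ w : HeightOneSpectrum (𝓞 K), IsConj (GLn.evalAt n K w (GLn.sndHom n K x)) (GLn.evalAt n K w (GLn.sndHom n K y)))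
    (hK : ∀ᶠ w : HeightOneSpectrum (𝓞 K) in cofinite, ∃ k ∈ glInt n (w.adicCompletion K),
      k * GLn.evalAt n K w (GLn.sndHom n K x) * k⁻¹ = GLn.evalAt n K w (GLn.sndHom n K y)) :
    IsConj x y := by
  classical
  obtain ⟨a, haeq⟩ := isConj_iff.1 ha
  -- at each finite place choose a conjugator, integral where `hK` provides one
  have hchoice : ∀ w : HeightOneSpectrum (𝓞 K), ∃ c : GL (Fin n) (w.adicCompletion K),
      c * GLn.evalAt n K w (GLn.sndHom n K x) * c⁻¹ = GLn.evalAt n K w (GLn.sndHom n K y) ∧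
        ((∃ k ∈ glInt n (w.adicCompletion K), k * GLn.evalAt n K w (GLn.sndHom n K x) * k⁻¹ = GLn.evalAt n K w (GLn.sndHom n K y)) →
          c ∈ glInt n (w.adicCompletion K)) := by
    intro w
    by_cases h : ∃ k ∈ glInt n (w.adicCompletion K), k * GLn.evalAt n K w (GLn.sndHom n K x) * k⁻¹ = GLn.evalAt n K w (GLn.sndHom n K y)
    · obtain ⟨k, hk, hkeq⟩ := h
      exact ⟨k, hkeq, fun _ => hk⟩
    · obtain ⟨c, hceq⟩ := isConj_iff.1 (hv w)
      exact ⟨c, hceq, fun h' => absurd h' h⟩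
  choose c hcconj hcint using hchoice
  have hc : ∀ᶠ w in cofinite, c w ∈ glInt n (w.adicCompletion K) := by
    filter_upwards [hK] with w hw
    exact hcint w hw
  obtain ⟨g, hga, hgw⟩ := GLn.exists_toMixed_eq_evalAt_eq a c hc
  refine isConj_iff.2 ⟨g, GLn.eq_of_toMixed_eq_of_forall_evalAt_eq ?_ fun w => ?_⟩
  · rw [map_mul, map_mul, map_inv, hga, haeq]
  · rw [map_mul, map_mul, map_inv, map_mul, map_mul, map_inv, hgw w, hcconj w]

/-- The finite part of the diagonal `γ ⊗ 1 ∈ GL_n(𝔸_K)` is the diagonal `γ ⊗ 1 ∈ GL_n(𝔸_K^∞)` (★ `UnitaryGroup.toFinAdeleGL`; definitional).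
[cite: BorelJacquet1979, §4.1] -/
theorem GLn.sndHom_toAdeleGL (γ : GL (Fin n) K) : GLn.sndHom n K (toAdeleGL K γ) = UnitaryGroup.toFinAdeleGL K n γ :=
  Units.ext (Matrix.ext fun _ _ => rfl)

/-- The `w`-component of `γ ⊗ 1 ∈ GL_n(𝔸_K)` is `γ` read in `GL_n(K_w)` (★ `UnitaryGroup.evalAt_toFinAdeleGL`). [cite: PlatonovRapinchuk1994, §5.1] -/
theorem GLn.evalAt_sndHom_toAdeleGL (γ : GL (Fin n) K) (w : HeightOneSpectrum (𝓞 K)) :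
    GLn.evalAt n K w (GLn.sndHom n K (toAdeleGL K γ)) = Matrix.GeneralLinearGroup.map (algebraMap K (w.adicCompletion K)) γ := by
  rw [GLn.sndHom_toAdeleGL, UnitaryGroup.evalAt_toFinAdeleGL]

/-- Conjugate elements of `GL_n(R)` have the same characteristic polynomial (Mathlib `Matrix.charpoly_units_conj`). [folklore] -/
private theorem charpoly_eq_of_isConj {R : Type*} [CommRing R] {m : Type*} [Fintype m] [DecidableEq m] {g g' : GL m R} (h : IsConj g g') :
    ((g' : GL m R) : Matrix m m R).charpoly = ((g : GL m R) : Matrix m m R).charpoly := by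
  obtain ⟨c, hc⟩ := isConj_iff.1 h
  rw [← hc, Units.val_mul, Units.val_mul, Matrix.coe_units_inv, Matrix.charpoly_units_conj]

/-- **Integral conjugators almost everywhere** ([Kt₄] Prop. 7.1 for `GL_n`): for `γ ∈ GL_n(K)` with SEPARABLE characteristic polynomial and
`y ∈ GL_n(𝔸_K)` with `(y_f)_w ∼ γ` in `GL_n(K_w)` for every `w`, for almost every `w` there is `k ∈ GL_n(𝒪_w)` with `k γ k⁻¹ = (y_f)_w` — at almost every
`w`, `γ` and `(y_f)_w` are integral (★ `GLn.eventually_evalAt_mem_glInt`) and the characteristic polynomial has a separable integral model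
(★ `eventually_exists_separable_lift`), so ★ `exists_mem_glInt_conj_eq_of_charpoly_eq` applies. [cite: Kottwitz1986, Prop. 7.1] [cite: Rogawski1990, §3.3 p. 21] -/
theorem GLn.eventually_exists_mem_glInt_conj_of_forall_isConj (γ : GL (Fin n) K) (hγ : ((γ : Matrix (Fin n) (Fin n) K).charpoly).Separable)
    (y : GL (Fin n) (AdeleRing (𝓞 K) K))
    (hv : ∀ w : HeightOneSpectrum (𝓞 K),
      IsConj (Matrix.GeneralLinearGroup.map (algebraMap K (w.adicCompletion K)) γ) (GLn.evalAt n K w (GLn.sndHom n K y))) :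
    ∀ᶠ w : HeightOneSpectrum (𝓞 K) in cofinite, ∃ k ∈ glInt n (w.adicCompletion K),
      k * Matrix.GeneralLinearGroup.map (algebraMap K (w.adicCompletion K)) γ * k⁻¹ = GLn.evalAt n K w (GLn.sndHom n K y) := by
  filter_upwards [GLn.eventually_evalAt_mem_glInt (UnitaryGroup.toFinAdeleGL K n γ), GLn.eventually_evalAt_mem_glInt (GLn.sndHom n K y),
    eventually_exists_separable_lift _ hγ] with w hγw hyw hsep
  rw [UnitaryGroup.evalAt_toFinAdeleGL] at hγw
  obtain ⟨q, hq, hqsep⟩ := hsep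
  refine exists_mem_glInt_conj_eq_of_charpoly_eq n w _ _ hγw hyw ⟨q, ?_, hqsep.map⟩ (charpoly_eq_of_isConj (hv w))
  rw [hq]
  exact (Matrix.charpoly_map (γ : Matrix (Fin n) (Fin n) K) (algebraMap K (w.adicCompletion K))).symm

/-- **`GL_n`-HASSE FOR REGULAR SEMISIMPLE RATIONAL CLASSES**: for `γ ∈ GL_n(K)` with separable characteristic polynomial and `y ∈ GL_n(𝔸_K)` with
`y_∞ ∼ γ ⊗ 1` in `GL_n(K ⊗ ℝ)` and `(y_f)_w ∼ γ` in `GL_n(K_w)` for every finite `w`, `y ∼ γ ⊗ 1` in `GL_n(𝔸_K)` — the gluing lemma with its integral clause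
supplied by `GLn.eventually_exists_mem_glInt_conj_of_forall_isConj`.  «An element of `𝐆` placewise (stably) conjugate to `γ`» IS an adelic conjugate of `γ`.
[cite: Rogawski1990, §3.3 pp. 21–22] [cite: Kottwitz1986, Prop. 7.1] -/
theorem GLn.isConj_toAdeleGL_of_isConj_toMixed_of_forall_isConj (γ : GL (Fin n) K) (hγ : ((γ : Matrix (Fin n) (Fin n) K).charpoly).Separable)
    {y : GL (Fin n) (AdeleRing (𝓞 K) K)} (ha : IsConj (GLn.toMixed n K (toAdeleGL K γ)) (GLn.toMixed n K y))
    (hv : ∀ w : HeightOneSpectrum (𝓞 K),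
      IsConj (Matrix.GeneralLinearGroup.map (algebraMap K (w.adicCompletion K)) γ) (GLn.evalAt n K w (GLn.sndHom n K y))) :
    IsConj (toAdeleGL K γ) y := by
  refine GLn.isConj_of_isConj_toMixed_of_forall_exists_conj ha (fun w => ?_) ?_
  · rw [GLn.evalAt_sndHom_toAdeleGL]
    exact hv w
  · filter_upwards [GLn.eventually_exists_mem_glInt_conj_of_forall_isConj γ hγ y hv] with w hw
    rw [GLn.evalAt_sndHom_toAdeleGL]
    exact hw

end GLGluing

end Literature.NumberTheory.Automorphic

namespace Literature.NumberTheory.Automorphic.UnitaryGroup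

open Literature.NumberTheory.Rogawski1990
open Literature.AlgebraicGeometry.ShimuraVarieties (unitaryGroup)

/-! ## §2 Placewise stable conjugacy to a regular rational `δ` IS `GL_N(𝔸_L)`-conjugacy to `δ ⊗ 1` -/

section CM

variable {L : Type} [Field L] [NumberField L] [IsCMField L] {N : ℕ} {H : Matrix (Fin N) (Fin N) L}

/-- The `w`-component (`w ∣ v`) of the `v`-component `g_v ∈ GL_N(∏_{w∣v} L_w)` of `g ∈ U(H)(𝔸)` is `(g_f)_w` (★ `GLn.evalAt` of ★ `GLn.sndHom`; definitional).
[cite: BorelJacquet1979, §4.1] -/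
theorem map_evalRingHom_coe_toLocal (v : HeightOneSpectrum (𝓞 ↥(maximalRealSubfield L))) (w : PlacesOver L v) (g : (cmDatum L N H).Adelic) :
    Matrix.GeneralLinearGroup.map (Pi.evalRingHom (fun w : PlacesOver L v => w.1.adicCompletion L) w)
        (((cmDatum L N H).toLocal v g).val : GL (Fin N) (LocalRing L v)) =
      GLn.evalAt N L w.1 (GLn.sndHom N L (g.val : GL (Fin N) (AdeleRing (𝓞 L) L))) :=
  Units.ext (Matrix.ext fun _ _ => rfl)

/-- **Placewise stable conjugacy to a regular rational `δ` IS `GL_N(𝔸_L)`-conjugacy**: for `δ ∈ U(H)(L⁺)` regular (★ `IsRegularElt`, separable characteristic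
polynomial) and `g ∈ U(H)(𝔸)` with `g_v` stably conjugate (conjugate in `GL_N(∏_{w∣v} L_w)`) to `(δ ⊗ 1)_v` at every finite place `v` of `L⁺` and `g_∞` stably
conjugate (in `GL_N(L ⊗ ℝ)`) to `δ ⊗ 1`, there is `x ∈ GL_N(𝔸_L)` with `x (δ ⊗ 1) x⁻¹ = g` — §1's `GL_N`-Hasse (`GLn.isConj_toAdeleGL_of_isConj_toMixed_of_forall_isConj`)
read through ★ `archPart_cmDatum_toAdelic` at `∞` and place by place above each `v`. [cite: Rogawski1990, §3.3 pp. 21–22; §5.4 p. 72] [cite: Kottwitz1986, Prop. 7.1] -/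
theorem exists_conj_toAdeleGL_eq_of_isStablyConj {δ : (cmDatum L N H).Rational} (hreg : IsRegularElt ((δ : unitaryGroup (cmConjRingHom L) H).val : GL (Fin N) L))
    {g : (cmDatum L N H).Adelic}
    (ha : IsStablyConj (conjMixed (↥(maximalRealSubfield L)) L (IsCMField.complexConj L)) (archFormOf L N H) (cmRationalToArch L N H δ)
      (archPart (↥(maximalRealSubfield L)) L (IsCMField.complexConj L) N H g))
    (hv : ∀ v : HeightOneSpectrum (𝓞 ↥(maximalRealSubfield L)),
      IsStablyConj (conjLocal L (IsCMField.complexConj L) v) ((adelicForm L N H).map (adeleToLocal L v))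
        ((cmDatum L N H).toLocal v ((cmDatum L N H).toAdelic δ)) ((cmDatum L N H).toLocal v g)) :
    ∃ x : GL (Fin N) (AdeleRing (𝓞 L) L),
      x * toAdeleGL L ((δ : unitaryGroup (cmConjRingHom L) H).val : GL (Fin N) L) * x⁻¹ = (g.val : GL (Fin N) (AdeleRing (𝓞 L) L)) := by
  refine isConj_iff.1 (GLn.isConj_toAdeleGL_of_isConj_toMixed_of_forall_isConj _ hreg ?_ fun w => ?_)
  · -- at `∞`: `(δ ⊗ 1)_∞ = cmRationalToArch δ`, `g_∞ = archPart g` on matrices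
    have h1 : GLn.toMixed N L (toAdeleGL L ((δ : unitaryGroup (cmConjRingHom L) H).val : GL (Fin N) L)) =
        ((cmRationalToArch L N H δ : arch (↥(maximalRealSubfield L)) L (IsCMField.complexConj L) N H) : GL (Fin N) (mixedEmbedding.mixedSpace L)) := by
      rw [← archPart_cmDatum_toAdelic]
      rfl
    rw [h1]
    exact ha
  · -- above `v = w ∩ L⁺`: the `w`-component of the `GL_N(∏_{w′∣v} L_{w′})`-conjugacy
    have h := MonoidHom.map_isConj (Matrix.GeneralLinearGroup.map (Pi.evalRingHom (fun w' : PlacesOver L (placesOver (↥(maximalRealSubfield L)) L w) =>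
      w'.1.adicCompletion L) ⟨w, rfl⟩)) (hv (placesOver (↥(maximalRealSubfield L)) L w))
    rw [map_evalRingHom_coe_toLocal, map_evalRingHom_coe_toLocal] at h
    rw [← GLn.evalAt_sndHom_toAdeleGL]
    exact h

end CM

end Literature.NumberTheory.Automorphic.UnitaryGroup

namespace Literature.NumberTheory.Rogawski1990

open Literature.NumberTheory.Automorphic
open Literature.AlgebraicGeometry.ShimuraVarieties (unitaryGroup)

section Self

variable {L : Type} [Field L] [NumberField L] [IsCMField L] {H : Matrix (Fin 3) (Fin 3) L} {γ₀ : (UnitaryGroup.cmDatum L 3 H).Rational}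

/-- **A MATCHING ADÈLE OVER A REGULAR `γ₀` IS `GL₃(𝔸_L)`-CONJUGATE TO `γ₀ ⊗ 1`** (self carrier `𝒪_st(γ₀ ∕ 𝐀) ⊂ U(H)(𝔸)`, ★ `MatchingAdeleG₂ L H H γ₀`): for
`γ₀ ∈ U(H)(L⁺)` regular and `p ∈ 𝒪_st(γ₀ ∕ 𝐀)` there is `g ∈ GL₃(𝔸_L)` with `g (γ₀ ⊗ 1) g⁻¹ = p` — «`γ′_v` is stably conjugate to `γ` in `G_v` for all `v`»
(★ `MatchingAdeleG₂.isStablyConj_toLocal`, ★ `MatchingAdeleG₂.isStablyConj_arch`) glued into ONE adelic conjugator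
(`UnitaryGroup.exists_conj_toAdeleGL_eq_of_isStablyConj`). [cite: Rogawski1990, §3.3 pp. 21–22; §5.4 p. 72] [cite: Kottwitz1986, Prop. 7.1] -/
theorem MatchingAdeleG₂.exists_gl_conj_eq_adele (hreg : IsRegularElt ((γ₀ : unitaryGroup (cmConjRingHom L) H).val : GL (Fin 3) L))
    (p : MatchingAdeleG₂ L H H γ₀) :
    ∃ g : GL (Fin 3) (AdeleRing (𝓞 L) L),
      g * (((UnitaryGroup.cmDatum L 3 H).toAdelic γ₀).val : GL (Fin 3) (AdeleRing (𝓞 L) L)) * g⁻¹ = (p.adele.val : GL (Fin 3) (AdeleRing (𝓞 L) L)) :=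
  UnitaryGroup.exists_conj_toAdeleGL_eq_of_isStablyConj hreg p.isStablyConj_arch p.isStablyConj_toLocal

/-- The same with the conjugator on the other side: `p = g (γ₀ ⊗ 1) g⁻¹` read as `IsConj` in `GL₃(𝔸_L)`. [cite: Rogawski1990, §3.3 pp. 21–22] -/
theorem MatchingAdeleG₂.isConj_toAdelic_adele_gl (hreg : IsRegularElt ((γ₀ : unitaryGroup (cmConjRingHom L) H).val : GL (Fin 3) L))
    (p : MatchingAdeleG₂ L H H γ₀) :
    IsConj (((UnitaryGroup.cmDatum L 3 H).toAdelic γ₀).val : GL (Fin 3) (AdeleRing (𝓞 L) L)) (p.adele.val : GL (Fin 3) (AdeleRing (𝓞 L) L)) :=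
  isConj_iff.2 (p.exists_gl_conj_eq_adele hreg)

end Self

end Literature.NumberTheory.Rogawski1990

/-! ## §3 The converse gluing in `U(H)(𝔸)`: placewise `U(H)`-conjugacy to a regular rational `δ` IS adelic conjugacy -/

namespace Literature.NumberTheory.Automorphic.UnitaryGroup

open Literature.NumberTheory.Rogawski1990
open Literature.AlgebraicGeometry.ShimuraVarieties (unitaryGroup)

section Converse

variable (L : Type) [Field L] [NumberField L] [IsCMField L] (N : ℕ) (H : Matrix (Fin N) (Fin N) L)

variable {L N H} in
/-- Conjugate local points have the same characteristic polynomial. [folklore] -/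
private theorem charpoly_coe_eq_of_isConj_local {v : HeightOneSpectrum (𝓞 ↥(maximalRealSubfield L))} {b b' : (cmDatum L N H).Local v}
    (h : IsConj b b') :
    (((b'.val : GL (Fin N) (LocalRing L v)) : Matrix (Fin N) (Fin N) (LocalRing L v))).charpoly =
      (((b.val : GL (Fin N) (LocalRing L v)) : Matrix (Fin N) (Fin N) (LocalRing L v))).charpoly := by
  obtain ⟨c, hc⟩ := isConj_iff.1 h
  have hc' : (c.val : GL (Fin N) (LocalRing L v)) * b.val * (c.val)⁻¹ = b'.val := by
    rw [← hc]
    rfl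
  rw [← hc', Units.val_mul, Units.val_mul, Matrix.coe_units_inv, Matrix.charpoly_units_conj]

/-- **THE CONVERSE GLUING — placewise `U(H)`-conjugacy to a regular rational `δ` IS adelic `U(H)(𝔸)`-conjugacy**: for `H` hermitian with `det H ≠ 0`,
`δ ∈ U(H)(L⁺)` regular and `g ∈ U(H)(𝔸)` with `g_∞ ∼ δ ⊗ 1` in `U(H)(L ⊗ ℝ)` (★ `cmRationalToArch`, ★ `archPart`) and `g_v ∼ (δ ⊗ 1)_v` in `U(H)(L⁺_v)` for
every finite `v`, `g ∼ δ ⊗ 1` in `U(H)(𝔸)`.  ★ `UnitaryGroup.isConj_of_isConj_archPart_of_forall_exists_conj` wants in addition an INTEGRAL conjugator at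
almost every `v`; this holds here: `(δ ⊗ 1)_v, g_v ∈ K_v = U(H)(𝒪_v)` for almost all `v` (★ `eventually_toLocal_mem_cmLocalIntegralLevel`), both with
characteristic polynomial `p_δ ⊗ 1`, `p_δ` separable, so [Kt₄] Prop. 7.1 (★ `eventually_forall_integralConj_cmDatum_of_charpoly_eq`) conjugates them inside
`K_v`. [cite: Rogawski1990, §3.3 pp. 21–22; §5.4 p. 72] [cite: Kottwitz1986, Prop. 7.1] -/
theorem isConj_toAdelic_of_isConj_arch_of_forall_isConj_toLocal (hH : (H.map (cmConjRingHom L))ᵀ = H) (hHd : H.det ≠ 0)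
    {δ : (cmDatum L N H).Rational} (hreg : IsRegularElt ((δ : unitaryGroup (cmConjRingHom L) H).val : GL (Fin N) L)) {g : (cmDatum L N H).Adelic}
    (ha : IsConj (cmRationalToArch L N H δ) (archPart (↥(maximalRealSubfield L)) L (IsCMField.complexConj L) N H g))
    (hv : ∀ v : HeightOneSpectrum (𝓞 ↥(maximalRealSubfield L)), IsConj ((cmDatum L N H).toLocal v ((cmDatum L N H).toAdelic δ)) ((cmDatum L N H).toLocal v g)) :
    IsConj ((cmDatum L N H).toAdelic δ) g := by
  refine isConj_of_isConj_archPart_of_forall_exists_conj (↥(maximalRealSubfield L)) L (IsCMField.complexConj L) N H ?_ hv ?_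
  · rw [← archPart_cmDatum_toAdelic] at ha
    exact ha
  · have hsep : ((((δ : unitaryGroup (cmConjRingHom L) H).val : GL (Fin N) L) : Matrix (Fin N) (Fin N) L).charpoly).Separable := hreg
    filter_upwards [eventually_forall_integralConj_cmDatum_of_charpoly_eq L N H hH hHd _ hsep,
      eventually_toLocal_mem_cmLocalIntegralLevel ((cmDatum L N H).toAdelic δ), eventually_toLocal_mem_cmLocalIntegralLevel g] with v hP hδv hgv
    have hchδ := charpoly_toLocal_toAdelic_eq_map H v δ
    exact hP _ _ hδv hgv hchδ ((charpoly_coe_eq_of_isConj_local (hv v)).trans hchδ)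

end Converse

end Literature.NumberTheory.Automorphic.UnitaryGroup

namespace Literature.NumberTheory.Rogawski1990

open Literature.NumberTheory.Automorphic
open Literature.AlgebraicGeometry.ShimuraVarieties (unitaryGroup)

section SelfConverse

variable {L : Type} [Field L] [NumberField L] [IsCMField L] {H : Matrix (Fin 3) (Fin 3) L} {γ₀ : (UnitaryGroup.cmDatum L 3 H).Rational}

/-- **A matching adèle conjugate to a regular rational `δ` place by place — in `U(H)(L⁺_v)` at every finite `v` and in `U(H)(L ⊗ ℝ)` at `∞` — is RATIONAL
OVER `δ`** (`p ∼ δ ⊗ 1` in `U(H)(𝔸)`, ★ `MatchingAdeleG₂.IsRationalOver`): the converse gluing `UnitaryGroup.isConj_toAdelic_of_isConj_arch_of_forall_isConj_toLocal`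
on the self carrier (`H` hermitian, `det H ≠ 0`). [cite: Rogawski1990, §3.3 pp. 21–22; §5.4 p. 72] [cite: Kottwitz1986, Prop. 7.1] -/
theorem MatchingAdeleG₂.isRationalOver_of_isConj_arch_of_forall_isConj_toLocal (hH : (H.map (cmConjRingHom L))ᵀ = H) (hHd : H.det ≠ 0)
    (p : MatchingAdeleG₂ L H H γ₀) {δ : (UnitaryGroup.cmDatum L 3 H).Rational}
    (hreg : IsRegularElt ((δ : unitaryGroup (cmConjRingHom L) H).val : GL (Fin 3) L))
    (ha : IsConj (cmRationalToArch L 3 H δ) p.arch)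
    (hv : ∀ v : HeightOneSpectrum (𝓞 ↥(maximalRealSubfield L)),
      IsConj ((UnitaryGroup.cmDatum L 3 H).toLocal v ((UnitaryGroup.cmDatum L 3 H).toAdelic δ)) ((UnitaryGroup.cmDatum L 3 H).toLocal v p.adele)) :
    p.IsRationalOver δ :=
  UnitaryGroup.isConj_toAdelic_of_isConj_arch_of_forall_isConj_toLocal L 3 H hH hHd hreg ha hv

end SelfConverse

end Literature.NumberTheory.Rogawski1990

end
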